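import Mathlib.Analysis.Calculus.MeanValue
import Literature.Analysis.FluidPDE.PassiveScalarClassicalEnergy
import Literature.Analysis.FluidPDE.PassiveScalarWellPosednessProofs
import Literature.Analysis.FluidPDE.EnergyToolkit
import HarnessLib

/-!
# Cold-start ceiling for the sourced passive scalar — negative lemma for line
`budgeted-mixer-template` of crux `TwoAndHalfD.ScalarAnomalySteadySourceFormal`
(stmt-AnomalousDissipation-0448), drefute seat.

Kernel-checked content (all over an arbitrary smooth divergence-free drift, any dimension):

* `hasDerivWithinAt_scalarL2Sq_forced` — the FORCED `L²` balance
  `d/dt ‖θ(t)‖² = -2κ‖∇θ(t)‖² + 2∫ s(t)θ(t)` for classical solutions of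
  `∂ₜθ + u·∇θ = κΔθ + s` on a convex time set (the unregistered support lemma U4 of the line card,
  needed inside `stub_coldStartVariance` and `stub_dissipationFromPower`).
* `coldStart_scalarL2Sq_le` — a cold start (`ρ(a) = 0`) of the `h`-sourced equation on `[a,b]`
  obeys `‖ρ(r)‖² ≤ (r-a)²‖h‖²` with constant EXACTLY one (fencing argument on
  `y' ≤ 2‖h‖√y`); `coldStart_power_le` — hence the input power `∫ h ρ(r) ≤ (r-a)‖h‖²`.
* `not_floor_lag_one_of_small` — consequently the (Floor) clause of `stub_sectorMixerRealizable`
  at lag count `n = 1` is incompatible with its (small) clause `4τ‖h‖² ≤ 2c₀` (`c₀ > 0`):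
  every witness of S1 has `n ≥ 2` (necessary condition NC1 of
  `Cruxes/ScalarAnomalySteadySourceFormal/DREFUTE-stub_sectorMixerRealizable.md`).

[folklore: DEIJ2022 (1.2)–(1.3) with a source; Evans 2010 §7.1.2]
-/

open MeasureTheory Set Filter
open _root_.Topology
open scoped InnerProductSpace ContDiff ENNReal NNReal

noncomputable section

namespace Summit.AnomalousDissipation.AnomalousDissipation.Theorems.ScalarAnomalySteadySourceFormal.Negative

open Literature.Analysis Literature.Analysis.FunctionSpaces
open Literature.Analysis.FluidPDE Literature.Analysis.FluidPDE.Torus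

set_option linter.dupNamespace false

variable {d : Type*} [Fintype d] [DecidableEq d]

section Balance

variable {S : Set ℝ} {κ : ℝ} {u : ℝ → UnitAddTorus d → EuclideanSpace ℝ d}
  {s θ : ℝ → UnitAddTorus d → ℝ}

/-- **U4, the forced `L²` balance.** For a classical solution of `∂ₜθ + u·∇θ = κΔθ + s`,
`div u = 0`, on a convex time set `S`:
`d/dt ‖θ(t)‖²_{L²} = -2κ‖∇θ(t)‖²_{L²} + 2∫ s(t) θ(t)` within `S`
(multiply by `θ`, integrate, `∫ θ u·∇θ = 0`, `∫ θΔθ = -‖∇θ‖²`; DEIJ 2022 (1.2) with a source).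
At an isolated point of `S` the statement is vacuous. [cite: DEIJ2022, (1.2)] -/
theorem hasDerivWithinAt_scalarL2Sq_forced (h : IsClassicalScalarTransportForcedOn S κ u s θ)
    (hS : Convex ℝ S) {t : ℝ} (ht : t ∈ S) :
    HasDerivWithinAt (fun σ => scalarL2Sq (θ σ))
      (-(2 * κ) * scalarGradNormSq (θ t) + 2 * ∫ x, s t x * θ t x) S t := by
  by_cases hacc : AccPt t (𝓟 S)
  swap
  · exact HasFDerivWithinAt.of_not_accPt hacc
  have hU : UniqueDiffOn ℝ S :=
    uniqueDiffOn_convex hS (FunctionSpaces.Torus.interior_nonempty_of_convex_of_accPt hS ht hacc)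
  have hθs := h.smooth_scalar
  have hθt : FunctionSpaces.Torus.IsSmooth (θ t) := hθs.isSmooth_slice ht
  have hut : FunctionSpaces.Torus.IsSmooth (u t) := h.smooth_velocity.isSmooth_slice ht
  have hst : FunctionSpaces.Torus.IsSmooth (s t) := h.smooth_source.isSmooth_slice ht
  -- differentiate `∫ θ²` under the integral sign
  have hφ : FunctionSpaces.Torus.IsSmoothSpaceTimeOn S (fun σ x => θ σ x * θ σ x) := hθs.mul hθs
  have hE := hφ.hasDerivWithinAt_integral hS ht
  have htd : ∀ x, FunctionSpaces.Torus.timeDerivWithin S (fun σ x => θ σ x * θ σ x) t x =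
      2 * (θ t x * FunctionSpaces.Torus.timeDerivWithin S θ t x) := by
    intro x
    have h2 : HasDerivWithinAt (fun τ => θ τ x * θ τ x)
        (FunctionSpaces.Torus.timeDerivWithin S θ t x * θ t x +
          θ t x * FunctionSpaces.Torus.timeDerivWithin S θ t x) S t :=
      (hθs.hasDerivWithinAt_slice ht x).mul (hθs.hasDerivWithinAt_slice ht x)
    rw [FunctionSpaces.Torus.timeDerivWithin, h2.derivWithin (hU t ht)]
    ring
  have hfun : (fun σ => scalarL2Sq (θ σ)) = fun σ => ∫ x, θ σ x * θ σ x := by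
    funext σ
    simp only [scalarL2Sq, sq]
  rw [hfun]
  refine hE.congr_deriv ?_
  -- evaluate `∫ 2 θ ∂ₜθ` with the equation and the two integrations by parts
  have hpt : (fun x => FunctionSpaces.Torus.timeDerivWithin S (fun σ x => θ σ x * θ σ x) t x) =
      fun x => 2 * (κ * (θ t x * FunctionSpaces.Torus.laplacian (θ t) x) -
        θ t x * ⟪u t x, FunctionSpaces.Torus.gradient (θ t) x⟫_ℝ + s t x * θ t x) := by
    funext x
    rw [htd x]
    have := h.transport t ht x
    have hre : FunctionSpaces.Torus.timeDerivWithin S θ t x =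
        κ * FunctionSpaces.Torus.laplacian (θ t) x - ⟪u t x, FunctionSpaces.Torus.gradient (θ t) x⟫_ℝ
          + s t x := by linarith
    rw [hre]
    ring
  have i1 : Integrable (fun x => θ t x * FunctionSpaces.Torus.laplacian (θ t) x) volume :=
    (hθt.smul' hθt.laplacian).integrable
  have i2 : Integrable (fun x => θ t x * ⟪u t x, FunctionSpaces.Torus.gradient (θ t) x⟫_ℝ) volume :=
    (hθt.smul' (hut.inner hθt.gradient)).integrable
  have i3 : Integrable (fun x => s t x * θ t x) volume := (hst.smul' hθt).integrable
  have i12 : Integrable (fun x => κ * (θ t x * FunctionSpaces.Torus.laplacian (θ t) x) -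
      θ t x * ⟪u t x, FunctionSpaces.Torus.gradient (θ t) x⟫_ℝ) volume := (i1.const_mul κ).sub i2
  rw [hpt, integral_const_mul, integral_add i12 i3,
    integral_sub (i1.const_mul κ) i2, integral_const_mul,
    integral_mul_laplacian_self_eq_neg_scalarGradNormSq hθt,
    integral_mul_inner_gradient_self_eq_zero hut (h.divFree t ht) hθt]
  ring

end Balance

section ColdStart

variable {κ a b : ℝ} {u : ℝ → UnitAddTorus d → EuclideanSpace ℝ d}
  {h : UnitAddTorus d → ℝ} {ρ : ℝ → UnitAddTorus d → ℝ}

omit [DecidableEq d] in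
/-- Cauchy–Schwarz for the input power: `∫ h·φ ≤ √‖h‖² · √‖φ‖²` for smooth slices. [folklore] -/
theorem integral_mul_le_sqrt_scalarL2Sq {φ : UnitAddTorus d → ℝ} (hh : FunctionSpaces.Torus.IsSmooth h)
    (hφ : FunctionSpaces.Torus.IsSmooth φ) :
    ∫ x, h x * φ x ≤ Real.sqrt (scalarL2Sq h) * Real.sqrt (scalarL2Sq φ) :=
  integral_mul_le_sqrt_mul_sqrt_of_memLp (hh.memLp 2) (hφ.memLp 2)

/-- **Cold-start ceiling (sharp constant).** A classical solution of `∂ₜρ + u·∇ρ = κΔρ + h`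
(`κ ≥ 0`, steady smooth source `h`) on `[a, b]`, `a < b`, starting from `ρ(a) = 0` satisfies
`‖ρ(r)‖²_{L²} ≤ (r - a)² ‖h‖²_{L²}` for all `r ∈ [a, b]`: the forced balance gives
`y' ≤ 2‖h‖√y` for `y = ‖ρ‖²`, and the fence `((‖h‖+ε)(r-a)+ε)²` is never crossed
(`image_le_of_deriv_right_lt_deriv_boundary`), then `ε → 0`. The constant `1` is what
`stub_coldStartVariance`'s `4τ²` requires (a Gronwall-linear bound would lose `e - 1`). [folklore] -/
theorem coldStart_scalarL2Sq_le (hκ : 0 ≤ κ) (hab : a < b)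
    (hρ : IsClassicalScalarTransportForcedOn (Icc a b) κ u (fun _ => h) ρ)
    (h0 : ρ a = fun _ => 0) :
    ∀ r ∈ Icc a b, scalarL2Sq (ρ r) ≤ (r - a) ^ 2 * scalarL2Sq h := by
  have hhs : FunctionSpaces.Torus.IsSmooth h := by
    have := hρ.smooth_source.isSmooth_slice (left_mem_Icc.2 hab.le)
    simpa using this
  set N : ℝ := Real.sqrt (scalarL2Sq h) with hN
  have hN0 : 0 ≤ N := Real.sqrt_nonneg _
  have hNsq : N ^ 2 = scalarL2Sq h := Real.sq_sqrt (scalarL2Sq_nonneg h)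
  set f : ℝ → ℝ := fun r => scalarL2Sq (ρ r) with hf
  set f' : ℝ → ℝ := fun r => -(2 * κ) * scalarGradNormSq (ρ r) + 2 * ∫ x, h x * ρ r x with hf'
  have hder : ∀ r ∈ Icc a b, HasDerivWithinAt f (f' r) (Icc a b) r := fun r hr =>
    hasDerivWithinAt_scalarL2Sq_forced hρ (convex_Icc a b) hr
  have hcont : ContinuousOn f (Icc a b) := fun r hr => (hder r hr).continuousWithinAt
  have hder' : ∀ r ∈ Ico a b, HasDerivWithinAt f (f' r) (Ici r) r := fun r hr =>
    (hder r (Ico_subset_Icc_self hr)).mono_of_mem_nhdsWithin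
      (mem_of_superset (Icc_mem_nhdsGE hr.2) (Icc_subset_Icc_left hr.1))
  -- the slope bound `f' ≤ 2 N √f`
  have hslope : ∀ r ∈ Icc a b, f' r ≤ 2 * N * Real.sqrt (f r) := by
    intro r hr
    have hρr : FunctionSpaces.Torus.IsSmooth (ρ r) := hρ.smooth_scalar.isSmooth_slice hr
    have hcs := integral_mul_le_sqrt_scalarL2Sq hhs hρr
    have hG : 0 ≤ scalarGradNormSq (ρ r) := scalarGradNormSq_nonneg _
    have : -(2 * κ) * scalarGradNormSq (ρ r) ≤ 0 := by nlinarith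
    simp only [hf', hf]
    linarith
  have hfa : f a = 0 := by
    simp only [hf, h0, scalarL2Sq]
    simp
  -- fence with `B_ε(r) = ((N+ε)(r-a)+ε)²` for every `ε > 0`
  have hfence : ∀ ε : ℝ, 0 < ε → ∀ r ∈ Icc a b, f r ≤ ((N + ε) * (r - a) + ε) ^ 2 := by
    intro ε hε r hr
    set c : ℝ → ℝ := fun x => (N + ε) * (x - a) + ε with hc
    set B : ℝ → ℝ := fun x => c x * c x with hB
    set B' : ℝ → ℝ := fun x => (N + ε) * c x + c x * (N + ε) with hB'
    have hcd : ∀ x, HasDerivAt c (N + ε) x := by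
      intro x
      simpa [hc] using (((hasDerivAt_id x).sub_const a).const_mul (N + ε)).add_const ε
    have hBd : ∀ x, HasDerivAt B (B' x) x := fun x => (hcd x).mul (hcd x)
    have hBa : f a ≤ B a := by
      rw [hfa]
      simp only [hB, hc, sub_self, mul_zero, zero_add]
      positivity
    have key : f r ≤ B r := by
      refine image_le_of_deriv_right_lt_deriv_boundary hcont hder' hBa hBd ?_ hr
      intro x hx hfx
      have hxa : 0 ≤ x - a := sub_nonneg.2 hx.1
      have hlin : 0 < c x := by
        have hm : 0 ≤ (N + ε) * (x - a) := mul_nonneg (by positivity) hxa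
        simp only [hc]
        linarith
      have hsq : Real.sqrt (f x) = c x := by
        rw [hfx]
        exact Real.sqrt_mul_self hlin.le
      calc f' x ≤ 2 * N * Real.sqrt (f x) := hslope x (Ico_subset_Icc_self hx)
        _ = 2 * N * c x := by rw [hsq]
        _ < 2 * (N + ε) * c x := by nlinarith
        _ = B' x := by simp only [hB']; ring
    simpa only [hB, hc, sq] using key
  -- let `ε → 0`
  intro r hr
  have hlim : Tendsto (fun ε : ℝ => ((N + ε) * (r - a) + ε) ^ 2) (𝓝[>] 0)
      (𝓝 (((N + 0) * (r - a) + 0) ^ 2)) := by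
    have hc : Continuous (fun ε : ℝ => ((N + ε) * (r - a) + ε) ^ 2) := by fun_prop
    exact (hc.tendsto 0).mono_left nhdsWithin_le_nhds
  have hev : ∀ᶠ ε in 𝓝[>] (0 : ℝ), f r ≤ ((N + ε) * (r - a) + ε) ^ 2 :=
    eventually_nhdsWithin_of_forall fun ε hε => hfence ε hε r hr
  have hle := ge_of_tendsto hlim hev
  calc scalarL2Sq (ρ r) = f r := rfl
    _ ≤ ((N + 0) * (r - a) + 0) ^ 2 := hle
    _ = (r - a) ^ 2 * scalarL2Sq h := by rw [← hNsq]; ring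

/-- **Cold-start input-power ceiling.** Under the hypotheses of `coldStart_scalarL2Sq_le`,
`∫ h · ρ(r) ≤ (r - a) ‖h‖²_{L²}` for `r ∈ [a, b]` (Cauchy–Schwarz). In the language of S1: the
(Floor) constant of any witness obeys `c₀ ≤ nτ‖h‖²`. [folklore] -/
theorem coldStart_power_le (hκ : 0 ≤ κ) (hab : a < b)
    (hρ : IsClassicalScalarTransportForcedOn (Icc a b) κ u (fun _ => h) ρ)
    (h0 : ρ a = fun _ => 0) {r : ℝ} (hr : r ∈ Icc a b) :
    ∫ x, h x * ρ r x ≤ (r - a) * scalarL2Sq h := by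
  have hhs : FunctionSpaces.Torus.IsSmooth h := by
    have := hρ.smooth_source.isSmooth_slice (left_mem_Icc.2 hab.le)
    simpa using this
  have hρr : FunctionSpaces.Torus.IsSmooth (ρ r) := hρ.smooth_scalar.isSmooth_slice hr
  have hcs := integral_mul_le_sqrt_scalarL2Sq hhs hρr
  have hsq := coldStart_scalarL2Sq_le hκ hab hρ h0 r hr
  have hra : 0 ≤ r - a := sub_nonneg.2 hr.1
  have hroot : Real.sqrt (scalarL2Sq (ρ r)) ≤ (r - a) * Real.sqrt (scalarL2Sq h) := by
    calc Real.sqrt (scalarL2Sq (ρ r)) ≤ Real.sqrt ((r - a) ^ 2 * scalarL2Sq h) :=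
          Real.sqrt_le_sqrt hsq
      _ = (r - a) * Real.sqrt (scalarL2Sq h) := by
          rw [Real.sqrt_mul (sq_nonneg _), Real.sqrt_sq hra]
  have hN0 : 0 ≤ Real.sqrt (scalarL2Sq h) := Real.sqrt_nonneg _
  calc ∫ x, h x * ρ r x ≤ Real.sqrt (scalarL2Sq h) * Real.sqrt (scalarL2Sq (ρ r)) := hcs
    _ ≤ Real.sqrt (scalarL2Sq h) * ((r - a) * Real.sqrt (scalarL2Sq h)) :=
        mul_le_mul_of_nonneg_left hroot hN0
    _ = (r - a) * (Real.sqrt (scalarL2Sq h) * Real.sqrt (scalarL2Sq h)) := by ring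
    _ = (r - a) * scalarL2Sq h := by rw [Real.mul_self_sqrt (scalarL2Sq_nonneg h)]

end ColdStart

section LagOne

/-- **NC1: lag count `n = 1` is impossible in `stub_sectorMixerRealizable`.** For `κ > 0`,
`τ > 0`, `c₀ > 0`, a smooth divergence-free drift `u` on `[0, ∞)` and a smooth profile `h` with
the (small) coupling at `n = 1`, `4τ‖h‖² ≤ 2c₀`, the (Floor) clause at lag `1·τ` FAILS: the
cold start from `s = 0` exists on `[0, τ]` (`exists_isClassicalScalarTransportForcedOn`) and its
input power is at most `τ‖h‖² ≤ c₀/2 < c₀` (`coldStart_power_le`). Hence every witness of S1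
has `n ≥ 2` (and, on paper with halving, `c₀ ≤ 2τ‖h‖²(1 - 2⁻ⁿ)`). [folklore] -/
theorem not_floor_lag_one_of_small {κ τ c₀ : ℝ} (hκ : 0 < κ) (hτ : 0 < τ) (hc₀ : 0 < c₀)
    {u : ℝ → UnitAddTorus d → EuclideanSpace ℝ d} (hu : FunctionSpaces.Torus.IsSmoothSpaceTimeOn (Ici 0) u)
    (hdiv : ∀ t ∈ Ici (0 : ℝ), FunctionSpaces.Torus.IsDivFree (u t))
    {h : UnitAddTorus d → ℝ} (hh : FunctionSpaces.Torus.IsSmooth h)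
    (hsmall : 4 * τ * scalarL2Sq h ≤ 2 ^ (1 : ℕ) * c₀) :
    ¬ (∀ s : ℝ, 0 ≤ s → ∀ ρ : ℝ → UnitAddTorus d → ℝ,
        IsClassicalScalarTransportForcedOn (Icc s (s + ((1 : ℕ) : ℝ) * τ)) κ u (fun _ => h) ρ →
        ρ s = (fun _ => (0 : ℝ)) → c₀ ≤ ∫ x, h x * ρ (s + ((1 : ℕ) : ℝ) * τ) x) := by
  intro hfloor
  have h01 : (0 : ℝ) + ((1 : ℕ) : ℝ) * τ = τ := by simp
  -- the cold start from `s = 0` on `[0, τ]`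
  have hu' : FunctionSpaces.Torus.IsSmoothSpaceTimeOn (Icc 0 τ) u := hu.mono Icc_subset_Ici_self
  have hdiv' : ∀ t ∈ Icc (0 : ℝ) τ, FunctionSpaces.Torus.IsDivFree (u t) := fun t ht => hdiv t (Icc_subset_Ici_self ht)
  have hsrc : FunctionSpaces.Torus.IsSmoothSpaceTimeOn (Icc 0 τ) (fun _ : ℝ => h) :=
    FunctionSpaces.Torus.isSmoothSpaceTimeOn_const hh _
  obtain ⟨ρ, hρ, hρ0⟩ := exists_isClassicalScalarTransportForcedOn hκ hτ hu' hdiv' hsrc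
    (FunctionSpaces.Torus.isSmooth_const (0 : ℝ))
  have hρ' : IsClassicalScalarTransportForcedOn (Icc 0 (0 + ((1 : ℕ) : ℝ) * τ)) κ u (fun _ => h) ρ := by
    rw [h01]; exact hρ
  have hfl := hfloor 0 le_rfl ρ hρ' hρ0
  rw [h01] at hfl
  have hpow := coldStart_power_le hκ.le hτ hρ hρ0 (right_mem_Icc.2 hτ.le)
  rw [sub_zero] at hpow
  have h2 : (2 : ℝ) ^ (1 : ℕ) = 2 := by norm_num
  rw [h2] at hsmall
  -- `c₀ ≤ τ‖h‖² ≤ c₀ / 2`, contradiction with `c₀ > 0`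
  linarith

end LagOne

end Summit.AnomalousDissipation.AnomalousDissipation.Theorems.ScalarAnomalySteadySourceFormal.Negative

end
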